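import Literature.Claims.NS.Kyritsis2021
import Literature.Analysis.FluidPDE.NSVorticityBKMHolds
import Literature.Analysis.FluidPDE.BaeChoeTwoVelocityComponentsCriterion
import Literature.Analysis.FluidPDE.NSSuitableESSPressureProofs
import HarnessLib

/-!
# Claim skeleton: Kyritsis (2017), «On the 4th Clay millennium problem: Proof of the regularity of
# the solutions of the Euler and Navier–Stokes equations, based on the conservation of particles»
# (J. Sci. Res. Stud. 4(11), 304–317 = K-I)

Cell `ns-claims` (D-0090 NS-CLAIMS SWEEP), claim C03c, typist `ns-claims-typist-3`.
UNREFEREED/DISPUTED CLAIM under adjudication — NOTHING in this file asserts a step: every `Step_k`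
is a `Prop` (the paper's k-th load-bearing assertion, typed concretely so that `¬ Step_k` or its
vacuity can be a kernel theorem, to be filed by a refuter summit-side as
`Theorems/SoloRefuteKyritsis2017.lean`); the only `theorem`s are kernel COMPOSITIONS of the paper's
own implications and unfolding lemmas.

Version of record (pinned by ns-claims-lit-3): K. E. Kyritsis, «On the 4th Clay millennium problem:
Proof of the regularity of the solutions of the Euler and Navier-Stokes equations, based on the
conservation of particles», J. Sci. Res. Stud. 4(11) (2017) 304–317 (HAL hal-01499089v4)
[Kyritsis2017]; print page = PDF page + 302 of `pub/ns-claims/sources/Kyritsis2022/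
JSRS2017-hal-01499089v4/`; locators below are PRINT pages. Same text: arXiv:1902.07265v1 part B,
1st paper. This is the author's FIRST regularity argument (an ADDED hypothesis, «conservation of
particles as local structure»); his later arguments are C03b (`Kyritsis2021.lean`, pressures —
its vocabulary `IsLocalClassSolution`, `energy`, `Step_2` (energy inequality) is re-used here by
import), C03 (`Kyritsis2022.lean`, circulation) and C03d (`Kyritsis2026.lean`, CKN).

## Claimed statement (as printed)

PROPOSITION 5.2, p. 315: «(Global regularity as in the 4th Clay Millennium problem). Let the
Navier-Stokes or Euler equations with smooth compact connected initial data, finite initial energy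
and conservation of particles as local structure. Then the unique local in time solutions are also
regular (are smooth globally in time).» Abstract, p. 304: «By formulating the later conservation
law and adding it to the hypotheses, it becomes possible to prove the regularity both for the Euler
and Navier-Stokes equations.» Typed: `ClaimedTheorem` — for every `ν ≥ 0` (Navier–Stokes `ν > 0`
and Euler `ν = 0`), every smooth solution on `[0,T)` in the class, from a datum with compact
connected support, that satisfies DEFINITION 5.1 on `[0,T)` (`ConservationOfParticles`) continues
in the class past `T` (so, with the maximal-development alternative of Prop. 4.11, the maximal
solution is global).

## Clay delta (reference `ClayVariants.lean`) — «WRONG PROBLEM» CANDIDATE, decided by the TYPE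

Nearest: (A). Axes: domain ℝ³ = · force ≡ 0 = · data: smooth with COMPACT CONNECTED support (Δ4,
narrower than Schwartz; the author's Prop. 4.4 p. 311 asserts the compact ⇔ Schwartz equivalence)
· solution notion: continuation of the local smooth solution (Δ6 form) · horizon [0,∞) · viscosity:
`ν > 0` AND `ν = 0` · **EXTRA HYPOTHESIS ON THE SOLUTION: Definition 5.1 (p. 314)** — uniform-in-time
control (`r`, `δx`, `δu`, `δω` fixed on `[0,T)`) of particle-range diameters, of the velocity
oscillation and of the first-derivative oscillation along the flow. The `ClaySpec` schema of
`ClayVariants.lean` has slots for data, force and admissibility of a solution, none for a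
hypothesis that the solution must satisfy BEFORE regularity is concluded: `ClaimedTheorem` is a
CONDITIONAL regularity statement and `clay_of_claimed : ClaimedTheorem → clayR3.Regularity` is NOT
derivable (and is not claimed derivable by the author, who «adds it to the hypotheses»). No
`clay_of_claimed` is stated. What the kernel records instead: the Navier–Stokes half of the
conditional claim FOLLOWS from two classical facts (the energy inequality and the `L^∞`-velocity
continuation criterion) — `claimNS_of_steps` with `step4_of_step1` PROVED — i.e. the paper proves
a true conditional statement that is not Clay (A).

## Steps (paper item · print page · typist's private flag)

* `Step_1`  the energy inequality, eqs. (8)–(13) p. 311 (Majda–Bertozzi Prop. 1.13 (1.80); the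
  author's «finiteness of the initial energy, and the conservation of energy» in the proof of
  Prop. 5.1) — verbatim `Kyritsis2021.Step_2` (same statement in the 2021 text) — plausible (known).
* `Step_2`  PROP 4.8 (p. 312), «necessary and sufficient condition for regularity» by the sup-norm
  of the velocity Jacobian, Euler AND Navier–Stokes: `sup_{t<T*} ‖∇u(t)‖_∞ < ∞ ⇒` continuation —
  true (Beale–Kato–Majda; PROVED below from the tree's discharged `beale_kato_majda`:
  `step2_holds`).
* `Step_3`  PROP 4.9 (p. 313, «Fefferman 2006», `ν > 0` only): bounded velocities on `[0,T*)` ⇒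
  continuation — plausible (known: the `L^∞_t L^∞_x` Prodi–Serrin endpoint) — PROVED in-file, `step_3_holds`
  (revision: the tree's Bae–Choe two-velocity-components criterion at the `L^∞_t L^∞_x` endpoint).
* `Step_4`  PROP 5.1 (pp. 314–315), 1st proof (Navier–Stokes; in fact `ν ≥ 0`): under Definition
  5.1 on `[0,T*)` and finite energy the velocities are bounded in sup-norm uniformly on `[0,T*)` —
  plausible; PROVED from `Step_1` (`step4_of_step1`: the printed energy argument (21)–(23) made
  quantitative, `M = δu + √(2E(0)/|B(r)|)`).
* `Step_5`  PROP 5.1, 2nd proof (p. 315, «both for the Euler and Navier-Stokes equations»): under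
  Definition 5.1 the velocity JACOBIAN is bounded in sup-norm uniformly on `[0,T*)` — plausible as a
  statement (it follows from conditions (2)+(3) by a mean-value argument, not typed); the PRINTED
  proof («the energy dissipation density … on balls that are particle-ranges goes to infinite …
  impossible from the finiteness of the initial energy») has no dissipation to invoke when `ν = 0`
  — erratum-grade support, recorded here, not typed.
Ordered index (TYPING-HYGIENE 11): Step 1 = `Step_1` (eqs. (8)–(13), p. 311) · Step 2 = `Step_2`
(Prop 4.8, p. 312) · Step 3 = `Step_3` (Prop 4.9, p. 313) · Step 4 = `Step_4` (Prop 5.1 1st proof,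
pp. 314–315) · Step 5 = `Step_5` (Prop 5.1 2nd proof, p. 315). Not typed as steps: §3 Defs 3.1–3.5
(pp. 307–308, the Clay text), Props 4.1–4.3 (local theory, Tao 2013 Thm 5.4), Prop 4.4 (compact ⇔
Schwartz, p. 311 — not consumed by Prop 5.2), Props 4.5–4.7, 4.10, Prop 4.11 (maximal development —
enters only the reading «continues past every finite T» of «regular»), §6 (turbulence measures).

## COMPOSITION — proved as `claim_of_steps`

* `claim_of_steps : Step_1 → … → Step_5 → ClaimedTheorem` — PROVED; consumes `Step_2` and `Step_5`
  (Prop 5.2's proof, p. 315: «we apply the part of the 2nd proof of the Proposition 5.1, which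
  concludes regularity from Proposition 4.8, which holds for both the Euler and Navier-Stokes
  equations»).
* `claimNS_of_steps : Step_3 → Step_4 → ClaimedTheoremNS` — PROVED (the Navier–Stokes route of the
  same proof: «We apply the Proposition 5.1 above and … Proposition 4.9»); with `step4_of_step1`
  this gives `claimNS_of_known : Step_1 → Step_3 → ClaimedTheoremNS` — PROVED.
* `step2_holds : Step_2` — PROVED (tree: Beale–Kato–Majda, discharged).

WHAT THIS IS NOT: not a claim about NS regularity or blow-up; not a claim about any author beyond the
typed locator.
-/

open MeasureTheory Set Filter
open scoped ContDiff ENNReal Topology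

namespace Literature.Claims.NS.Kyritsis2017

open Literature.Analysis.FluidPDE
open Literature.Claims.NS.Kyritsis2021 (IsLocalClassSolution energy)

noncomputable section

/-! ## Vocabulary (definitions with bodies; nothing asserted) -/

/-- «F the point trajectories mapping of the flow» (Definition 5.1, p. 314): a two-time trajectory
map `X s t` of the velocity field on `[0,T)` — `X s s = id` and `∂ₜ X s t x = u(t, X s t x)` for
`s ≤ t < T` (one-sided in time). [cite: Kyritsis2017, Definition 5.1, p. 314] -/
structure IsTrajectoryMap (u : ℝ → EuclideanSpace ℝ (Fin 3) → EuclideanSpace ℝ (Fin 3)) (T : ℝ)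
    (X : ℝ → ℝ → EuclideanSpace ℝ (Fin 3) → EuclideanSpace ℝ (Fin 3)) : Prop where
  init : ∀ s ∈ Ico 0 T, ∀ x, X s s x = x
  hasDeriv : ∀ s ∈ Ico 0 T, ∀ x, ∀ t ∈ Ico s T,
    HasDerivWithinAt (fun τ => X s τ x) (u t (X s t x)) (Ico s T) t

/-- **DEFINITION 5.1 (p. 314), «conservation of particles in the interval [0,T) … as a local
structure of the solution»**, in the whole-space reading the definition allows («We may assume
initial data on all of R³ or only on a connected compact support V₀ … in the case of initial data
on R³, it has infinite cover»): «There is a small radius r, and small constants δx, δu, δω > 0 so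
that for all t in [0,T), there is a … cover Cₜ of Vₜ, from balls B(r) of radius r, called "ranges of
the particles", such that: (1) For an x₁ and x₂ in a ball B(r) of V_s, s in [0,T),
‖F(x₁) − F(x₂)‖ ≤ r + δx for all t ≥ s in [0,T). (2) … ‖u(F(x₁)) − u(F(x₂))‖ ≤ δu for all t ≥ s in
[0,T). (3) … ‖g(F(x₁)) − g(F(x₂))‖ ≤ δω for all t ≥ s in [0,T)», `g` = the first-order space and
space-time derivatives `∂ₓ^α ∂ₜ^b u`, `|α| = 1`, `|b| ≤ 1` (typed: the spatial derivative of `u(t,·)`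
and of the one-sided time derivative `∂ₜu(t,·)`). Local finiteness of the cover is dropped (w.l.o.g.
for covers by balls of a fixed radius). [cite: Kyritsis2017, Definition 5.1, p. 314] -/
def ConservationOfParticles (u : ℝ → EuclideanSpace ℝ (Fin 3) → EuclideanSpace ℝ (Fin 3))
    (T : ℝ) : Prop :=
  ∃ X : ℝ → ℝ → EuclideanSpace ℝ (Fin 3) → EuclideanSpace ℝ (Fin 3), IsTrajectoryMap u T X ∧
    ∃ r : ℝ, 0 < r ∧ ∃ δx : ℝ, 0 < δx ∧ ∃ δu : ℝ, 0 < δu ∧ ∃ δω : ℝ, 0 < δω ∧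
      ∀ s ∈ Ico 0 T, ∃ 𝒞 : Set (EuclideanSpace ℝ (Fin 3)),
        (∀ x : EuclideanSpace ℝ (Fin 3), ∃ c ∈ 𝒞, x ∈ Metric.ball c r) ∧
        ∀ c ∈ 𝒞, ∀ x₁ ∈ Metric.ball c r, ∀ x₂ ∈ Metric.ball c r, ∀ t ∈ Ico s T,
          ‖X s t x₁ - X s t x₂‖ ≤ r + δx ∧
          ‖u t (X s t x₁) - u t (X s t x₂)‖ ≤ δu ∧
          ‖fderiv ℝ (u t) (X s t x₁) - fderiv ℝ (u t) (X s t x₂)‖ ≤ δω ∧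
          ‖fderiv ℝ (timeDerivWithin (Ico 0 T) u t) (X s t x₁) -
              fderiv ℝ (timeDerivWithin (Ico 0 T) u t) (X s t x₂)‖ ≤ δω

/-- What condition (2) of Definition 5.1 gives at `t = s` (the only instance the 1st proof of
Prop. 5.1 consumes, eq. (22) p. 315: «x_n(t_n) belongs to one such ball or particle-range B_n(r)
and for any other point y(t_n) of B_n(r), it holds that ‖u(x_n(t_n),t_n) − u(y(t_n),t_n)‖ ≤ δu»):
every point lies in a ball of radius `r` on which the velocity oscillation at time `t` is at most
`δu`. PROVED from the definition (`X s s = id`). [cite: Kyritsis2017, proof of Prop 5.1, eq. (22), p. 315] -/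
theorem ConservationOfParticles.oscillation
    {u : ℝ → EuclideanSpace ℝ (Fin 3) → EuclideanSpace ℝ (Fin 3)} {T : ℝ}
    (h : ConservationOfParticles u T) :
    ∃ r : ℝ, 0 < r ∧ ∃ δu : ℝ, 0 < δu ∧ ∀ t ∈ Ico 0 T, ∀ x : EuclideanSpace ℝ (Fin 3),
      ∃ c : EuclideanSpace ℝ (Fin 3), x ∈ Metric.ball c r ∧
        ∀ y ∈ Metric.ball c r, ‖u t x - u t y‖ ≤ δu := by
  obtain ⟨X, hX, r, hr, δx, _, δu, hδu, δω, _, hcov⟩ := h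
  refine ⟨r, hr, δu, hδu, fun t ht x => ?_⟩
  obtain ⟨𝒞, hcover, hballs⟩ := hcov t ht
  obtain ⟨c, hc, hx⟩ := hcover x
  refine ⟨c, hx, fun y hy => ?_⟩
  have h := (hballs c hc x hx y hy t ⟨le_rfl, ht.2⟩).2.1
  rwa [hX.init t ht x, hX.init t ht y] at h

/-! ## The claimed statement -/

/-- **PROPOSITION 5.2 (p. 315), as printed — CONDITIONAL regularity:** for the Navier–Stokes
(`ν > 0`) AND the Euler (`ν = 0`) equations, every smooth solution on `[0,T)` in the class (the
paper's Prop. 4.1–4.2 smooth class, rendered as in `Kyritsis2021.IsLocalClassSolution`) whose datum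
has compact connected support (hence finite energy) and which satisfies Definition 5.1 on `[0,T)`
continues in the class past `T` («the unique local in time solutions are also regular (are smooth
globally in time)», read with the maximal development of Prop. 4.11 p. 313: no finite maximal
time). The hypothesis `ConservationOfParticles u T` bears on the SOLUTION — this is not Clay (A)
(see the module docstring; no `clay_of_claimed`). [cite: Kyritsis2017, Prop 5.2, p. 315] -/
def ClaimedTheorem : Prop :=
  ∀ ν : ℝ, 0 ≤ ν → ∀ T : ℝ, 0 < T →
    ∀ (u : ℝ → EuclideanSpace ℝ (Fin 3) → EuclideanSpace ℝ (Fin 3))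
      (p : ℝ → EuclideanSpace ℝ (Fin 3) → ℝ), IsLocalClassSolution ν T u p →
      HasCompactSupport (u 0) → IsConnected (Function.support (u 0)) →
      ConservationOfParticles u T → HasSobolevExtensionPast ν u T

/-- The Navier–Stokes half (`ν > 0`) of `ClaimedTheorem`. [cite: Kyritsis2017, Prop 5.2, p. 315] -/
def ClaimedTheoremNS : Prop :=
  ∀ ν : ℝ, 0 < ν → ∀ T : ℝ, 0 < T →
    ∀ (u : ℝ → EuclideanSpace ℝ (Fin 3) → EuclideanSpace ℝ (Fin 3))
      (p : ℝ → EuclideanSpace ℝ (Fin 3) → ℝ), IsLocalClassSolution ν T u p →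
      HasCompactSupport (u 0) → IsConnected (Function.support (u 0)) →
      ConservationOfParticles u T → HasSobolevExtensionPast ν u T

/-- `ClaimedTheorem` contains its Navier–Stokes half. [cite: Kyritsis2017, Prop 5.2, p. 315] -/
theorem claimedNS_of_claimed (h : ClaimedTheorem) : ClaimedTheoremNS :=
  fun ν hν => h ν hν.le

/-! ## The steps -/

/-- **Step 1 — the energy inequality, eqs. (8)–(13), p. 311** («E(0) ≥ E(T)» (12), «dE/dt =
−ν∫|∇u|² < 0» (13); Majda–Bertozzi Prop. 1.13 (1.80)) — the «finiteness of the initial energy,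
and the conservation of energy» invoked in the proof of Prop. 5.1 (p. 315). Verbatim the step
`Kyritsis2021.Step_2` of the 2021 text (same equations (8)–(13)). Typist's flag: plausible
(known). [cite: Kyritsis2017, eqs. (8)–(13), p. 311] -/
def Step_1 : Prop :=
  Literature.Claims.NS.Kyritsis2021.Step_2

/-- **Step 2 — PROPOSITION 4.8 (p. 312), «necessary and sufficient condition for regularity»:**
«The local solution u(x,t), t in [0,T*) of the Euler or Navier-Stokes equations, with smooth
compact connected support initial data, can be extended to [0,T*] … if and only if … there exist
a bound M > 0, so that … ‖∇u(x,t)‖_∞ ≤ M for all t in [0,T*)» (19) — the sufficiency direction,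
`ν ≥ 0`. Typist's flag: true (Beale–Kato–Majda, `|curl u| ≤ 2√3 |∇u|`; `step2_holds`).
[cite: Kyritsis2017, Prop 4.8 eq. (19), p. 312] -/
def Step_2 : Prop :=
  ∀ ν : ℝ, 0 ≤ ν → ∀ T : ℝ, 0 < T →
    ∀ (u : ℝ → EuclideanSpace ℝ (Fin 3) → EuclideanSpace ℝ (Fin 3))
      (p : ℝ → EuclideanSpace ℝ (Fin 3) → ℝ), IsLocalClassSolution ν T u p →
      HasCompactSupport (u 0) →
      (∃ M : ℝ, ∀ t ∈ Ico 0 T, ∀ x : EuclideanSpace ℝ (Fin 3), ‖fderiv ℝ (u t) x‖ ≤ M) →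
      HasSobolevExtensionPast ν u T

/-- **Step 3 — PROPOSITION 4.9 (p. 313; «Fefferman, 2006», Navier–Stokes only):** «The local
solution u(x,t), t in [0,T*) of the Navier-Stokes equations with non-zero viscosity, and with
smooth compact connected support initial data, can be extended to [0,T*] … if and only if the
velocities ‖u(x,t)‖ do not get unbounded as t → T*» — sufficiency direction, typed with a uniform
bound on `[0,T*)`. Typist's flag: plausible (known: Prodi–Serrin endpoint `L^∞_t L^∞_x`; the Clay
text p. 2 states the blow-up of `sup|u|` at a finite blow-up time). [cite: Kyritsis2017, Prop 4.9, p. 313] -/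
def Step_3 : Prop :=
  ∀ ν : ℝ, 0 < ν → ∀ T : ℝ, 0 < T →
    ∀ (u : ℝ → EuclideanSpace ℝ (Fin 3) → EuclideanSpace ℝ (Fin 3))
      (p : ℝ → EuclideanSpace ℝ (Fin 3) → ℝ), IsLocalClassSolution ν T u p →
      HasCompactSupport (u 0) →
      (∃ M : ℝ, ∀ t ∈ Ico 0 T, ∀ x : EuclideanSpace ℝ (Fin 3), ‖u t x‖ ≤ M) →
      HasSobolevExtensionPast ν u T

/-- **Step 4 — PROPOSITION 5.1 (pp. 314–315), 1st proof:** «Let … smooth local in time in [0,T*),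
velocity fields solutions of the Navier-Stokes or Euler equations, with compact connected support
V(0) initial data, finite initial energy E(0) and conservation of particles in [0,T*) as a local
structure … Then for t in [0,T*) and x in V(t), the velocities are uniformly in time bounded in
the supremum norm by a bound M independent of time t.» Typed in the whole-space reading of
Definition 5.1 (bound at every point of ℝ³), `ν ≥ 0`. Typist's flag: plausible — PROVED from
`Step_1` (`step4_of_step1`). [cite: Kyritsis2017, Prop 5.1, pp. 314–315] -/
def Step_4 : Prop :=
  ∀ ν : ℝ, 0 ≤ ν → ∀ T : ℝ, 0 < T →
    ∀ (u : ℝ → EuclideanSpace ℝ (Fin 3) → EuclideanSpace ℝ (Fin 3))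
      (p : ℝ → EuclideanSpace ℝ (Fin 3) → ℝ), IsLocalClassSolution ν T u p →
      HasCompactSupport (u 0) → ConservationOfParticles u T →
      ∃ M : ℝ, ∀ t ∈ Ico 0 T, ∀ x : EuclideanSpace ℝ (Fin 3), ‖u t x‖ ≤ M

/-- **Step 5 — PROPOSITION 5.1, 2nd proof (p. 315), «both for the Euler and Navier-Stokes
equations»:** «Instead of utilizing the condition (2) of the definition 5.1, we may utilize the
condition (3). And we start assuming that the Jacobian of the velocities is unbounded in the
supremum norm …, as time goes to the Blow-up time T*. Similarly, we conclude that the energy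
dissipation density at a time on balls that are particle-ranges goes to infinite, … which again is
impossible from the finiteness of the initial energy and energy conservation.» Typed as the
conclusion Prop. 5.2 consumes: under Definition 5.1 the velocity Jacobian is bounded in sup-norm
uniformly on `[0,T*)`, `ν ≥ 0`. Typist's flag: plausible as a statement (conditions (2)+(3) and a
mean-value estimate bound `‖∇u‖` by `δu/r + 2δω`); the printed dissipation argument is void for
`ν = 0` (no dissipation) — erratum-grade support. [cite: Kyritsis2017, Prop 5.1 2nd proof, p. 315] -/
def Step_5 : Prop :=
  ∀ ν : ℝ, 0 ≤ ν → ∀ T : ℝ, 0 < T →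
    ∀ (u : ℝ → EuclideanSpace ℝ (Fin 3) → EuclideanSpace ℝ (Fin 3))
      (p : ℝ → EuclideanSpace ℝ (Fin 3) → ℝ), IsLocalClassSolution ν T u p →
      HasCompactSupport (u 0) → ConservationOfParticles u T →
      ∃ M : ℝ, ∀ t ∈ Ico 0 T, ∀ x : EuclideanSpace ℝ (Fin 3), ‖fderiv ℝ (u t) x‖ ≤ M

/-! ## Kernel compositions of the paper's implications -/

/-- **PROP 5.2's printed proof COMPOSES** (p. 315: «we apply the part of the 2nd proof of the
Proposition 5.1, which concludes regularity from Proposition 4.8, which holds for both the Euler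
and Navier-Stokes equations»): the claimed conditional theorem from Steps 1–5 (hypotheses in step
order; consumes `Step_2`, `Step_5`). [cite: Kyritsis2017, proof of Prop 5.2, p. 315] -/
theorem claim_of_steps : Step_1 → Step_2 → Step_3 → Step_4 → Step_5 → ClaimedTheorem := by
  intro _ h2 _ _ h5 ν hν T hT u p hsol hcpt _ hcons
  exact h2 ν hν T hT u p hsol hcpt (h5 ν hν T hT u p hsol hcpt hcons)

/-- **The Navier–Stokes route of the same proof** (p. 315: «We apply the Proposition 5.1 above and
the necessary and sufficient condition for regularity in Proposition 4.9 (which is only for the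
Navier-Stokes equations)»). [cite: Kyritsis2017, proof of Prop 5.2, p. 315] -/
theorem claimNS_of_steps (h3 : Step_3) (h4 : Step_4) : ClaimedTheoremNS := by
  intro ν hν T hT u p hsol hcpt _ hcons
  exact h3 ν hν T hT u p hsol hcpt (h4 ν hν.le T hT u p hsol hcpt hcons)

/-- Bookkeeping: the `n = 0` Sobolev quantity of the BKM class is the `L²` energy integrand.
[folklore] -/
private theorem lintegral_enorm_iteratedFDeriv_zero
    (f : EuclideanSpace ℝ (Fin 3) → EuclideanSpace ℝ (Fin 3)) :
    (∫⁻ x, ‖iteratedFDeriv ℝ 0 f x‖ₑ ^ 2) = ∫⁻ x, ‖f x‖ₑ ^ 2 := by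
  refine lintegral_congr fun x => ?_
  rw [← ofReal_norm, norm_iteratedFDeriv_zero, ofReal_norm]

/-- **PROP 5.1's 1st proof, made quantitative in the kernel: Step 1 ⇒ Step 4.** At time `t`, a
point `x` lies in a particle range `B(c,r)` on which `|u(t,·)| ≥ |u(t,x)| − δu` (condition (2) at
`s = t`, eq. (22)); integrating over the ball (eqs. (23)), `|B(r)|·(|u(t,x)| − δu)₊² ≤ ∫|u(t)|² =
2E(t) ≤ 2E(0)`, so `|u(t,x)| ≤ δu + √(2E(0)/|B(r)|)` uniformly on `[0,T)` («This is impossible by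
the finiteness of the initial energy, and the conservation of energy», p. 315).
[cite: Kyritsis2017, proof of Prop 5.1, eqs. (21)–(23), p. 315] -/
theorem step4_of_step1 (h1 : Step_1) : Step_4 := by
  intro ν hν T hT u p hsol _ hcons
  obtain ⟨r, hr, δu, hδu, hosc⟩ := hcons.oscillation
  -- the initial energy integral K = ∫|u(0)|² is finite (class solution, n = 0)
  set K : ℝ≥0∞ := ∫⁻ y, ‖u 0 y‖ₑ ^ 2 with hK
  have hKtop : K < ⊤ := by
    obtain ⟨C, hC⟩ := hsol.2 (T / 2) (by linarith) 0
    have hle : K ≤ C := by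
      rw [hK, ← lintegral_enorm_iteratedFDeriv_zero]
      exact hC 0 ⟨le_rfl, by linarith⟩
    exact hle.trans_lt ENNReal.coe_lt_top
  -- the volume of a particle range
  set V : ℝ≥0∞ := volume (Metric.ball (0 : EuclideanSpace ℝ (Fin 3)) r) with hV
  have hV0 : V ≠ 0 := (Metric.measure_ball_pos volume (0 : EuclideanSpace ℝ (Fin 3)) hr).ne'
  have hVtop : V ≠ ⊤ := measure_ball_lt_top.ne
  -- the bound
  refine ⟨δu + Real.sqrt ((K / V).toReal), fun t ht x => ?_⟩
  obtain ⟨c, hxc, hball⟩ := hosc t ht x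
  -- energy at time t is at most the initial energy
  have hEt : (∫⁻ y, ‖u t y‖ₑ ^ 2) ≤ K := by
    have hmono := (h1 ν hν).1 T hT u p hsol 0 ⟨le_rfl, hT⟩ t ht ht.1
    unfold energy at hmono
    exact (ENNReal.mul_le_mul_iff_right (by simp) (by simp)).mp hmono
  -- lower bound on the particle range: |u(t,y)| ≥ |u(t,x)| − δu for y ∈ B(c,r)
  set a : ℝ := ‖u t x‖ - δu with ha
  rcases le_or_gt a 0 with ha0 | ha0
  · have : ‖u t x‖ ≤ δu := by linarith
    exact this.trans (le_add_of_nonneg_right (Real.sqrt_nonneg _))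
  · have hlow : ∀ y ∈ Metric.ball c r, ENNReal.ofReal a ≤ ‖u t y‖ₑ := fun y hy => by
      rw [← ofReal_norm]
      apply ENNReal.ofReal_le_ofReal
      have h := hball y hy
      have : ‖u t x‖ ≤ ‖u t x - u t y‖ + ‖u t y‖ := by
        simpa using norm_add_le (u t x - u t y) (u t y)
      linarith
    have hball_int : ENNReal.ofReal a ^ 2 * V ≤ ∫⁻ y in Metric.ball c r, ‖u t y‖ₑ ^ 2 := by
      rw [hV, ← Measure.addHaar_ball_center volume c r, ← setLIntegral_const]
      refine setLIntegral_mono' Metric.isOpen_ball.measurableSet fun y hy => ?_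
      gcongr
      exact hlow y hy
    have hchain : ENNReal.ofReal a ^ 2 * V ≤ K :=
      hball_int.trans ((setLIntegral_le_lintegral _ _).trans hEt)
    have hdiv : ENNReal.ofReal a ^ 2 ≤ K / V :=
      (ENNReal.le_div_iff_mul_le (Or.inl hV0) (Or.inl hVtop)).mpr hchain
    have hKV : K / V ≠ ⊤ := (ENNReal.div_lt_top hKtop.ne hV0).ne
    have hsq : a ^ 2 ≤ (K / V).toReal := by
      rw [← ENNReal.ofReal_pow ha0.le] at hdiv
      exact (ENNReal.ofReal_le_iff_le_toReal hKV).mp hdiv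
    have hle : a ≤ Real.sqrt ((K / V).toReal) := by
      rw [← Real.sqrt_sq ha0.le]
      exact Real.sqrt_le_sqrt hsq
    rw [ha] at hle
    linarith

/-- **The Navier–Stokes half of the claim from two classical facts** — the energy inequality
(`Step_1`) and the `L^∞`-velocity continuation criterion (`Step_3`, Prop. 4.9).
[cite: Kyritsis2017, Props 5.1–5.2, pp. 314–315] -/
theorem claimNS_of_known (h1 : Step_1) (h3 : Step_3) : ClaimedTheoremNS :=
  claimNS_of_steps h3 (step4_of_step1 h1)

/-- A pointwise bound `‖curl v x‖ ≤ 6‖Dv(x)‖` (each of the three entries of the curl is a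
difference of two entries of the Jacobian, each bounded by the operator norm). [folklore] -/
private theorem norm_curl_le (v : EuclideanSpace ℝ (Fin 3) → EuclideanSpace ℝ (Fin 3))
    (x : EuclideanSpace ℝ (Fin 3)) : ‖curl v x‖ ≤ 6 * ‖fderiv ℝ v x‖ := by
  -- entries of the Jacobian are bounded by the operator norm
  have hD : ∀ j i : Fin 3, |fderiv ℝ v x (EuclideanSpace.single j 1) i| ≤ ‖fderiv ℝ v x‖ := by
    intro j i
    have h1 : |fderiv ℝ v x (EuclideanSpace.single j 1) i| ≤
        ‖fderiv ℝ v x (EuclideanSpace.single j 1)‖ := by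
      simpa [Real.norm_eq_abs] using
        PiLp.norm_apply_le (fderiv ℝ v x (EuclideanSpace.single j 1)) i
    have h2 : ‖fderiv ℝ v x (EuclideanSpace.single j 1)‖ ≤ ‖fderiv ℝ v x‖ := by
      simpa using (fderiv ℝ v x).le_opNorm (EuclideanSpace.single j (1 : ℝ))
    exact h1.trans h2
  -- each entry of the curl is bounded by 2‖Dv‖
  have hc : ∀ i : Fin 3, |curl v x i| ≤ 2 * ‖fderiv ℝ v x‖ := by
    intro i
    fin_cases i
    · have := hD 1 2; have := hD 2 1
      simp [curl]
      calc |fderiv ℝ v x (EuclideanSpace.single 1 1) 2 - fderiv ℝ v x (EuclideanSpace.single 2 1) 1|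
          ≤ |fderiv ℝ v x (EuclideanSpace.single 1 1) 2| +
            |fderiv ℝ v x (EuclideanSpace.single 2 1) 1| := abs_sub _ _
        _ ≤ 2 * ‖fderiv ℝ v x‖ := by linarith
    · have := hD 2 0; have := hD 0 2
      simp [curl]
      calc |fderiv ℝ v x (EuclideanSpace.single 2 1) 0 - fderiv ℝ v x (EuclideanSpace.single 0 1) 2|
          ≤ |fderiv ℝ v x (EuclideanSpace.single 2 1) 0| +
            |fderiv ℝ v x (EuclideanSpace.single 0 1) 2| := abs_sub _ _
        _ ≤ 2 * ‖fderiv ℝ v x‖ := by linarith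
    · have := hD 0 1; have := hD 1 0
      simp [curl]
      calc |fderiv ℝ v x (EuclideanSpace.single 0 1) 1 - fderiv ℝ v x (EuclideanSpace.single 1 1) 0|
          ≤ |fderiv ℝ v x (EuclideanSpace.single 0 1) 1| +
            |fderiv ℝ v x (EuclideanSpace.single 1 1) 0| := abs_sub _ _
        _ ≤ 2 * ‖fderiv ℝ v x‖ := by linarith
  -- Euclidean norm from the entries
  have hsq : ∀ i : Fin 3, ‖curl v x i‖ ^ 2 ≤ (2 * ‖fderiv ℝ v x‖) ^ 2 := fun i => by
    rw [Real.norm_eq_abs]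
    exact pow_le_pow_left₀ (abs_nonneg _) (hc i) 2
  have hsum : ∑ i : Fin 3, ‖curl v x i‖ ^ 2 ≤ (6 * ‖fderiv ℝ v x‖) ^ 2 := by
    rw [Fin.sum_univ_three]
    have h0 := hsq 0; have h1 := hsq 1; have h2 := hsq 2
    nlinarith [norm_nonneg (fderiv ℝ v x)]
  rw [EuclideanSpace.norm_eq]
  calc Real.sqrt (∑ i : Fin 3, ‖curl v x i‖ ^ 2) ≤ Real.sqrt ((6 * ‖fderiv ℝ v x‖) ^ 2) :=
        Real.sqrt_le_sqrt hsum
    _ = 6 * ‖fderiv ℝ v x‖ := Real.sqrt_sq (by positivity)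

/-- **Step 2 (PROP 4.8) holds** — from the tree's Beale–Kato–Majda theorem
(`beale_kato_majda_holds`): a uniform bound on the velocity Jacobian bounds `‖curl u(t)‖_∞`, so
`∫₀ᵀ ‖curl u‖_∞ dt ≤ 6MT < ∞` and the solution continues in the class (`ν ≥ 0`).
[cite: Kyritsis2017, Prop 4.8, p. 312] -/
theorem step2_holds : Step_2 := by
  intro ν hν T hT u p hsol _ hM
  obtain ⟨M, hM⟩ := hM
  refine (beale_kato_majda_holds hν hT hsol.1 hsol.2).mpr ?_
  have hbound : ∀ t ∈ Ioo 0 T, (⨆ x, ‖curl (u t) x‖ₑ) ≤ ENNReal.ofReal (6 * M) := by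
    intro t ht
    refine iSup_le fun x => ?_
    rw [← ofReal_norm]
    exact ENNReal.ofReal_le_ofReal ((norm_curl_le (u t) x).trans
      (by nlinarith [hM t ⟨ht.1.le, ht.2⟩ x, norm_nonneg (fderiv ℝ (u t) x)]))
  calc (∫⁻ t in Ioo 0 T, ⨆ x, ‖curl (u t) x‖ₑ)
      ≤ ∫⁻ _ in Ioo 0 T, ENNReal.ofReal (6 * M) := setLIntegral_mono' measurableSet_Ioo hbound
    _ = ENNReal.ofReal (6 * M) * volume (Ioo 0 T) := setLIntegral_const _ _
    _ < ⊤ := ENNReal.mul_lt_top ENNReal.ofReal_lt_top (by simp [Real.volume_Ioo])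

/-- **The whole conditional claim from Step 5 alone, modulo the tree** (Step 2 being a theorem).
[cite: Kyritsis2017, proof of Prop 5.2, p. 315] -/
theorem claim_of_step5 (h5 : Step_5) : ClaimedTheorem :=
  fun ν hν T hT u p hsol hcpt _ hcons =>
    step2_holds ν hν T hT u p hsol hcpt (h5 ν hν T hT u p hsol hcpt hcons)


/-! ## Step 3 discharged: PROP 4.9 (p. 313), bounded velocity ⇒ continuation in the class, `ν > 0` -/

/-- A bounded velocity field on `[0,T) × ℝ³` with continuous slices has every component in
`L^∞_t L^∞_x` on `(0,T)` (the tree's mixed-norm class `MemLqLp ∞ ∞`). [folklore] -/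
private theorem memLqLp_top_top_component {T M : ℝ}
    {u : ℝ → EuclideanSpace ℝ (Fin 3) → EuclideanSpace ℝ (Fin 3)}
    (hcont : ∀ t ∈ Ico 0 T, Continuous (u t)) (hM : ∀ t ∈ Ico 0 T, ∀ x, ‖u t x‖ ≤ M) (j : Fin 3) :
    MemLqLp ∞ ∞ (fun t x => u t x j) (Ioo 0 T) := by
  refine memLqLp_top_of_ae_slice_bound (C := ENNReal.ofReal M) ENNReal.ofReal_ne_top ?_
  refine (ae_restrict_iff' measurableSet_Ioo).2 (ae_of_all _ fun t ht => ?_)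
  have htI : t ∈ Ico 0 T := ⟨ht.1.le, ht.2⟩
  have hmeas : AEStronglyMeasurable (fun x => u t x j) volume :=
    (((EuclideanSpace.proj j : EuclideanSpace ℝ (Fin 3) →L[ℝ] ℝ).continuous).comp
      (hcont t htI)).aestronglyMeasurable
  have hbound : ∀ᵐ x ∂(volume : Measure (EuclideanSpace ℝ (Fin 3))), ‖u t x j‖ ≤ M :=
    ae_of_all _ fun x => (PiLp.norm_apply_le (u t x) j).trans (hM t htI x)
  refine ⟨memLp_top_of_bound hmeas M hbound, ?_⟩
  rw [eLpNorm_exponent_top]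
  exact eLpNormEssSup_le_of_ae_bound hbound

/-- **Step 3 HOLDS (kernel)** — PROPOSITION 4.9 (p. 313), the `L^∞`-velocity continuation criterion at
`ν > 0`: every class solution on `[0,T*)` whose velocity is bounded on `[0,T*) × ℝ³` continues in
the Beale–Kato–Majda class past `T*` — by the tree's two-velocity-components criterion at the
`L^∞_t L^∞_x` endpoint (`baeChoe_two_velocity_components_criterion_top_of_le`: all three components
are bounded, so any two are). The compact-support hypothesis is not used. The same statement is
independently kernel-certified Summits-side by the salvage lane
(`Summit.NavierStokesRegularity.NavierStokesRegularity.Theorems.Kyritsis2017Salvage.step3_holds` in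
`SoloSalvageKyritsis2017.lean`, whose proof this discharge follows); it is re-proved here, where the
fact is declared, because Literature cannot import Summits. No statement of the file is modified.
[cite: Kyritsis2017, Prop 4.9, p. 313] [cite: BaeChoe2007CPDE, Thm. 1] -/
theorem step_3_holds : Step_3 := by
  intro ν hν T hT u p hsol _ hbdd
  obtain ⟨M, hM⟩ := hbdd
  have hcont : ∀ t ∈ Ico 0 T, Continuous (u t) := fun t ht =>
    (hsol.1.contDiff_velocity ht).continuous
  exact baeChoe_two_velocity_components_criterion_top_of_le hν hT hsol.1 hsol.2 (α := ⊤) le_top 0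
    fun j _ => memLqLp_top_top_component hcont hM j

/-! ## Step 5 discharged: PROP 5.1, 2nd proof (p. 315) — Definition 5.1 (2)+(3) bound the velocity Jacobian, every `ν ≥ 0` -/

section Step5

open Metric

variable {E F : Type*} [NormedAddCommGroup E] [NormedSpace ℝ E] [NormedAddCommGroup F]
  [NormedSpace ℝ F]

/-- An operator bounded by `a + b‖z‖` on the open ball of radius `r` has norm `≤ a / r + b`.
[folklore] -/
private theorem opNorm_le_of_affine_bound_on_ball (L : E →L[ℝ] F) (r a b : ℝ) (hr : 0 < r)
    (ha : 0 ≤ a) (hb : 0 ≤ b) (h : ∀ z : E, ‖z‖ < r → ‖L z‖ ≤ a + b * ‖z‖) :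
    ‖L‖ ≤ a / r + b := by
  refine le_of_forall_pos_le_add fun ε hε => ?_
  obtain ⟨k, hk1, hkε⟩ : ∃ k : ℝ, 1 < k ∧ (k - 1) * a / r ≤ ε := by
    have hpos : 0 < a + 1 := by linarith
    have hq : 0 < ε * r / (a + 1) := by positivity
    refine ⟨1 + ε * r / (a + 1), by linarith, ?_⟩
    rw [show (1 + ε * r / (a + 1) - 1) = ε * r / (a + 1) by ring, div_le_iff₀ hr]
    rw [div_mul_eq_mul_div, div_le_iff₀ hpos]
    nlinarith
  have hkpos : 0 < k := by linarith
  have hC : 0 ≤ k * a / r + b := by positivity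
  have : ‖L‖ ≤ k * a / r + b := by
    have hkabs : 1 < ‖(k : ℝ)‖ := by rw [Real.norm_eq_abs, abs_of_pos hkpos]; exact hk1
    refine ContinuousLinearMap.opNorm_le_of_shell (c := (k : ℝ)) hr hC hkabs ?_
    intro z hz1 hz2
    have hz : ‖z‖ < r := hz2
    have hbound := h z hz
    have hkz : r / ‖(k : ℝ)‖ ≤ ‖z‖ := hz1
    rw [Real.norm_eq_abs, abs_of_pos hkpos] at hkz
    have h1 : a ≤ k * a / r * ‖z‖ := by
      have : r ≤ k * ‖z‖ := by
        rw [div_le_iff₀ hkpos] at hkz; linarith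
      calc a = a * r / r := by field_simp
        _ ≤ a * (k * ‖z‖) / r := by gcongr
        _ = k * a / r * ‖z‖ := by ring
    calc ‖L z‖ ≤ a + b * ‖z‖ := hbound
      _ ≤ k * a / r * ‖z‖ + b * ‖z‖ := by linarith
      _ = (k * a / r + b) * ‖z‖ := by ring
  calc ‖L‖ ≤ k * a / r + b := this
    _ = a / r + b + (k - 1) * a / r := by ring
    _ ≤ a / r + b + ε := by linarith

/-- Mean-value estimate at the centre of a particle range: if on `B(c,r)` the field oscillates by
at most `δu` and its derivative by at most `δω`, then `‖∇u(c)‖ ≤ δu/r + δω` (the mean-value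
inequality applied to `y ↦ u y − ∇u(c)(y − c)`). [folklore] -/
private theorem opNorm_fderiv_center_le (u : E → F) (c : E) (r δu δω : ℝ) (hr : 0 < r)
    (hδu : 0 ≤ δu) (hδω : 0 ≤ δω) (hdiff : ∀ y ∈ ball c r, DifferentiableAt ℝ u y)
    (hu : ∀ y ∈ ball c r, ‖u y - u c‖ ≤ δu)
    (hD : ∀ y ∈ ball c r, ‖fderiv ℝ u y - fderiv ℝ u c‖ ≤ δω) :
    ‖fderiv ℝ u c‖ ≤ δu / r + δω := by
  set L : E →L[ℝ] F := fderiv ℝ u c with hL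
  let g : E → F := fun y => u y - L (y - c)
  have hg : ∀ y ∈ ball c r, ‖g y - g c‖ ≤ δω * ‖y - c‖ := by
    intro y hy
    have hconv : Convex ℝ (ball c r) := convex_ball c r
    have hgdiff : ∀ z ∈ ball c r, DifferentiableAt ℝ g z := by
      intro z hz
      exact ((hdiff z hz).sub ((L.differentiableAt).comp z (differentiableAt_id.sub_const c)))
    have hgbound : ∀ z ∈ ball c r, ‖fderiv ℝ g z‖ ≤ δω := by
      intro z hz
      have h1 : HasFDerivAt (fun y : E => y - c) (ContinuousLinearMap.id ℝ E) z :=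
        (hasFDerivAt_id z).sub_const c
      have h2 : HasFDerivAt (fun y : E => L (y - c)) (L.comp (ContinuousLinearMap.id ℝ E)) z :=
        L.hasFDerivAt.comp z h1
      have h3 : HasFDerivAt g (fderiv ℝ u z - L.comp (ContinuousLinearMap.id ℝ E)) z :=
        (hdiff z hz).hasFDerivAt.sub h2
      rw [h3.fderiv, ContinuousLinearMap.comp_id]
      exact hD z hz
    exact hconv.norm_image_sub_le_of_norm_fderiv_le hgdiff hgbound (mem_ball_self hr) hy
  have hmain : ∀ z : E, ‖z‖ < r → ‖L z‖ ≤ δu + δω * ‖z‖ := by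
    intro z hz
    have hy : c + z ∈ ball c r := by
      rw [mem_ball, dist_eq_norm]; simpa using hz
    have h1 := hg (c + z) hy
    have h2 := hu (c + z) hy
    have hgc : g c = u c := by simp [g]
    have hgy : g (c + z) = u (c + z) - L z := by simp [g]
    rw [hgy, hgc] at h1
    have hsimp : ‖c + z - c‖ = ‖z‖ := by simp
    rw [hsimp] at h1
    calc ‖L z‖ = ‖(u (c + z) - u c) - (u (c + z) - L z - u c)‖ := by congr 1; abel
      _ ≤ ‖u (c + z) - u c‖ + ‖u (c + z) - L z - u c‖ := norm_sub_le _ _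
      _ ≤ δu + δω * ‖z‖ := by linarith
  exact opNorm_le_of_affine_bound_on_ball L r δu δω hr hδu hδω hmain

/-- The Jacobian bound at every point of a particle range: `‖∇u(x)‖ ≤ δu/r + 2δω` for `x ∈ B(c,r)`.
[folklore] -/
private theorem opNorm_fderiv_le_of_range (u : E → F) (c : E) (r δu δω : ℝ) (hr : 0 < r)
    (hδu : 0 ≤ δu) (hδω : 0 ≤ δω) (hdiff : ∀ y ∈ ball c r, DifferentiableAt ℝ u y)
    (hu : ∀ y ∈ ball c r, ‖u y - u c‖ ≤ δu)
    (hD : ∀ y ∈ ball c r, ‖fderiv ℝ u y - fderiv ℝ u c‖ ≤ δω) (x : E) (hx : x ∈ ball c r) :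
    ‖fderiv ℝ u x‖ ≤ δu / r + 2 * δω := by
  have h1 := opNorm_fderiv_center_le u c r δu δω hr hδu hδω hdiff hu hD
  have h2 := hD x hx
  calc ‖fderiv ℝ u x‖ = ‖(fderiv ℝ u x - fderiv ℝ u c) + fderiv ℝ u c‖ := by congr 1; abel
    _ ≤ ‖fderiv ℝ u x - fderiv ℝ u c‖ + ‖fderiv ℝ u c‖ := norm_add_le _ _
    _ ≤ δω + (δu / r + δω) := by linarith
    _ = δu / r + 2 * δω := by ring

/-- **Step 5 HOLDS (kernel) — for every `ν ≥ 0`** (PROP 5.1, 2nd proof, p. 315, the printed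
CONCLUSION «the Jacobian of the velocities is bounded in the supremum norm uniformly on [0,T*)»
under Definition 5.1): conditions (2)+(3) of Definition 5.1 at `s = t` (trajectories start at the
identity, `IsTrajectoryMap.init`) give, on each particle range `B(c, r)` at time `t`,
`‖u(t,y) − u(t,c)‖ ≤ δu` and `‖∇u(t,y) − ∇u(t,c)‖ ≤ δω`; the mean-value inequality applied to
`y ↦ u(t,y) − ∇u(t,c)(y − c)` gives `‖∇u(t,c)‖ ≤ δu/r + δω`, hence `‖∇u(t,x)‖ ≤ δu/r + 2δω` at
every point (the ranges cover the space). No dissipation is used: the printed proof's appeal to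
the «energy dissipation density» (void at `ν = 0`) is an erratum of the PROOF, not of the typed
statement. The same statement is independently kernel-certified Summits-side
(`Summit.NavierStokesRegularity.NavierStokesRegularity.Theorems.Kyritsis2017Salvage.step5_holds` in
`SoloSalvageKyritsis2017Step5.lean`, referee seat ns-claims-ref-2, whose proof this discharge follows
verbatim); it is re-proved here, where the fact is declared, because Literature cannot import
Summits. An in-file discharge; no statement of the file is modified.
[cite: Kyritsis2017, Prop 5.1 2nd proof, p. 315] -/
theorem step_5_holds : Step_5 := by
  intro ν hν T hT u p hsol hcpt hcons
  obtain ⟨X, hX, r, hr, δx, _, δu, hδu, δω, hδω, hcov⟩ := hcons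
  refine ⟨δu / r + 2 * δω, fun t ht x => ?_⟩
  obtain ⟨𝒞, hcover, hballs⟩ := hcov t ht
  obtain ⟨c, hc, hx⟩ := hcover x
  have hsmooth : ContDiff ℝ ∞ (u t) := hsol.1.contDiff_velocity ht
  have hdiff : ∀ y ∈ ball c r, DifferentiableAt ℝ (u t) y := fun y _ =>
    hsmooth.differentiable (by simp) y
  have hcc : c ∈ ball c r := mem_ball_self hr
  have htt : t ∈ Ico t T := ⟨le_rfl, ht.2⟩
  have hu : ∀ y ∈ ball c r, ‖u t y - u t c‖ ≤ δu := by
    intro y hy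
    have h := (hballs c hc y hy c hcc t htt).2.1
    rwa [hX.init t ht y, hX.init t ht c] at h
  have hD : ∀ y ∈ ball c r, ‖fderiv ℝ (u t) y - fderiv ℝ (u t) c‖ ≤ δω := by
    intro y hy
    have h := (hballs c hc y hy c hcc t htt).2.2.1
    rwa [hX.init t ht y, hX.init t ht c] at h
  exact opNorm_fderiv_le_of_range (u t) c r δu δω hr hδu.le hδω.le hdiff hu hD x hx

end Step5

/-- **The printed conditional PROPOSITION 5.2 (p. 315), as typed (`ν ≥ 0`: Euler and Navier–Stokes
halves), is a theorem** — `claim_of_step5 step_5_holds` (Step 5 + PROP 4.8 = Beale–Kato–Majda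
continuation, `step2_holds`). The adjudication of C03c is by TYPE only: the hypothesis
`ConservationOfParticles u T` bears on the solution, not on a Clay (A) datum (module docstring; no
`clay_of_claimed`). Summits twin:
`Summit.NavierStokesRegularity.NavierStokesRegularity.Theorems.Kyritsis2017Salvage.claimedTheorem_holds`.
[cite: Kyritsis2017, Prop 5.2, p. 315] -/
theorem claimedTheorem_holds : ClaimedTheorem :=
  claim_of_step5 step_5_holds

/-! ## Steps 1 and 4 and the Navier–Stokes half, from the energy inequality of the 2021 file -/

/-- **Step 1 HOLDS (kernel) — for every `ν ≥ 0`**: the energy inequality (8)–(13), p. 311, typed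
as `Kyritsis2021.Step_2`, is discharged in `Literature.Claims.NS.Kyritsis2021`
(`Kyritsis2021.step_2_holds`, Leray's identity for finite-energy classical solutions, `ν ≥ 0`).
Summits twin: `…Theorems.Kyritsis2021Salvage.kyritsis2017_step1_holds`.
[cite: Kyritsis2017, eqs. (8)–(13), p. 311] -/
theorem step_1_holds : Step_1 :=
  Literature.Claims.NS.Kyritsis2021.step_2_holds

/-- **Step 4 HOLDS (kernel) — for every `ν ≥ 0`** (PROP 5.1, pp. 314–315, 1st proof as made
quantitative in `step4_of_step1`): under Definition 5.1 the velocity is bounded in sup-norm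
uniformly on `[0,T*)`, by `|B(r)|·(|u(t,x)| − δu)₊² ≤ 2E(t) ≤ 2E(0)`.
[cite: Kyritsis2017, Prop 5.1, pp. 314–315] -/
theorem step_4_holds : Step_4 :=
  step4_of_step1 step_1_holds

/-- **The Navier–Stokes half of PROPOSITION 5.2 (p. 315) by the paper's own Navier–Stokes route**
(«We apply the Proposition 5.1 above and … Proposition 4.9»): `claimNS_of_known step_1_holds
step_3_holds`. (Also a corollary of `claimedTheorem_holds` via `claimedNS_of_claimed`.) Summits twin:
`Summit.NavierStokesRegularity.NavierStokesRegularity.Theorems.Kyritsis2017Salvage.claimedTheoremNS_holds`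
(`SoloSalvageKyritsis2017.lean`). [cite: Kyritsis2017, Prop 5.2, p. 315] -/
theorem claimedTheoremNS_holds : ClaimedTheoremNS :=
  claimNS_of_known step_1_holds step_3_holds

/-- `ClaimedTheoremNS` — `_holds` alias of `claimedTheoremNS_holds` above under the fact's exact name (appended
2026-08-28, D-0026 bookkeeping: the proof term is the existing theorem of this file; no statement,
definition or attribute is edited; no new named fact; the ledger's debt table listed the fact
unproved). [cite: Kyritsis2017, Prop 5.2, p. 315] -/
theorem _root_.Literature.Claims.NS.Kyritsis2017.ClaimedTheoremNS_holds : ClaimedTheoremNS :=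
  _root_.Literature.Claims.NS.Kyritsis2017.claimedTheoremNS_holds

end

end Literature.Claims.NS.Kyritsis2017
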